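import Summits.ValiantsHypothesis.ValiantsHypothesis.Theorems.MonotoneRestorationOrbitRestorationQPBlockProducts
import HarnessLib

/-!
# Worked example: `Π_{i<j} Π_k (x_ik − x_jk)` for even `n` — twisted support blocks, untwisted row-pair blocks (ORBIT currency, XXII)

Route MonotoneRestoration, crux `OrbitRestorationQP` (stmt-ValiantsHypothesis-18293), namespace
`Summit.ValiantsHypothesis.ValiantsHypothesis.Theorems.BlockProducts`.

The simplest sign-twisted symmetric ΠΣ family for which blocking by SUPPORTS fails: `P₁ = Π_{i<j} Π_k (x_ik − x_jk)`
is invariant under independent row and column permutations when `n` is even (a row transposition flips `n`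
factors), but its support blocks `{x_ac − x_bc, x_ab − x_cb, x_ba − x_ca}` (support `{a,b,c}`) are negated by the
transposition `(a b)` while `C(n−2, 1)` is even — the twist is invisible to global invariance (census W16,
`Cruxes/OrbitRestorationQP/PISIGMA-SUBRUNG.md`).  Keying by the ROW PAIR instead works: `u_{ab} := Π_k (x_ak − x_bk)`
satisfies `u_{ba} = (−1)^n u_{ab} = u_{ab}`, is equivariant on unordered pairs, and its operand multiset is permuted
exactly by the pointwise stabiliser of `{a,b}` (the column index is free).  Hence (`rowPairs_qpOrbitRestorable`)
`P₁` is `QPOrbitRestorable 8` for even `n`, by the block criterion with blocks `Sym2 (Fin n)`.  Everything is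
proved. [folklore]
-/

noncomputable section

open scoped Classical

-- `Summit.ValiantsHypothesis.ValiantsHypothesis.…` is the tree's single-conjunct layout (Sub = Summit).
set_option linter.dupNamespace false

namespace Summit.ValiantsHypothesis.ValiantsHypothesis.Theorems

namespace BlockProducts

open Equiv Finset Literature.Computability.AlgebraicComplexity OrbitRestorationQPDepthThreeRung

variable {n : ℕ}

/-- Renaming the row-pair block `{x_ik − x_jk : k}` by `σ` gives the block of `(σ i, σ j)`. [folklore] -/
theorem map_ren_rowBlock (σ : Perm (Fin n)) (i j : Fin n) :
    ((univ : Finset (Fin n)).val.map fun k : Fin n =>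
        (MvPolynomial.X (i, k) - MvPolynomial.X (j, k) : MvPolynomial (Fin n × Fin n) ℂ)).map (ren σ) =
      (univ : Finset (Fin n)).val.map fun k : Fin n =>
        (MvPolynomial.X (σ i, k) - MvPolynomial.X (σ j, k) : MvPolynomial (Fin n × Fin n) ℂ) := by
  conv_rhs => rw [← Multiset.map_univ_val_equiv σ]
  rw [Multiset.map_map, Multiset.map_map]
  refine Multiset.map_congr rfl fun k _ => ?_
  simp only [Function.comp_apply, map_sub, ren_X, Prod.smul_mk, Perm.smul_def]

/-- For even `n` the row-pair block product `Π_k (x_ik − x_jk)` is symmetric in `(i, j)`. [folklore] -/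
theorem rowBlock_prod_comm (hn : Even n) (i j : Fin n) :
    ((univ : Finset (Fin n)).val.map fun k : Fin n =>
        (MvPolynomial.X (i, k) - MvPolynomial.X (j, k) : MvPolynomial (Fin n × Fin n) ℂ)).prod =
      ((univ : Finset (Fin n)).val.map fun k : Fin n =>
        (MvPolynomial.X (j, k) - MvPolynomial.X (i, k) : MvPolynomial (Fin n × Fin n) ℂ)).prod := by
  rw [← Finset.prod_eq_multiset_prod, ← Finset.prod_eq_multiset_prod]
  have hneg : ∀ k : Fin n, (MvPolynomial.X (j, k) - MvPolynomial.X (i, k) : MvPolynomial (Fin n × Fin n) ℂ) =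
      -(MvPolynomial.X (i, k) - MvPolynomial.X (j, k)) := fun k => by ring
  simp only [hneg]
  rw [Finset.prod_neg, Finset.card_univ, Fintype.card_fin, hn.neg_one_pow, one_mul]

/-- **`Π_{i<j} Π_k (x_ik − x_jk)` is `QPOrbitRestorable 8` for even `n`** (blocks = unordered row pairs
`b ∈ Sym2 (Fin n)`, the block of `b` being `{x_{(inf b) k} − x_{(sup b) k} : k}`, empty on the diagonal).
[folklore] -/
theorem rowPairs_qpOrbitRestorable (n : ℕ) (hn : Even n) :
    QPOrbitRestorable 8 n (∏ b : Sym2 (Fin n), if b.IsDiag then 1 else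
      ((univ : Finset (Fin n)).val.map fun k : Fin n =>
        (MvPolynomial.X (b.inf, k) - MvPolynomial.X (b.sup, k) : MvPolynomial (Fin n × Fin n) ℂ)).prod) := by
  letI : MulAction (Perm (Fin n)) (Sym2 (Fin n)) :=
    { smul := fun σ b => Sym2.map σ b
      one_smul := fun b => by
        change Sym2.map (⇑(1 : Perm (Fin n))) b = b
        rw [Perm.coe_one, Sym2.map_id, id]
      mul_smul := fun σ τ b => by
        change Sym2.map (⇑(σ * τ)) b = Sym2.map σ (Sym2.map τ b)
        rw [Perm.coe_mul, Sym2.map_map] }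
  have hsmul : ∀ (σ : Perm (Fin n)) (i j : Fin n), σ • (s(i, j) : Sym2 (Fin n)) = s(σ i, σ j) :=
    fun σ i j => rfl
  let N : Fin n → Fin n → Multiset (MvPolynomial (Fin n × Fin n) ℂ) := fun i j =>
    (univ : Finset (Fin n)).val.map fun k : Fin n =>
      (MvPolynomial.X (i, k) - MvPolynomial.X (j, k) : MvPolynomial (Fin n × Fin n) ℂ)
  have hN : ∀ i j, N i j = (univ : Finset (Fin n)).val.map fun k : Fin n =>
      (MvPolynomial.X (i, k) - MvPolynomial.X (j, k) : MvPolynomial (Fin n × Fin n) ℂ) := fun _ _ => rfl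
  let M : Sym2 (Fin n) → Multiset (MvPolynomial (Fin n × Fin n) ℂ) := fun b =>
    if b.IsDiag then 0 else N b.inf b.sup
  have hM : ∀ b, M b = if b.IsDiag then 0 else N b.inf b.sup := fun _ => rfl
  have hprod_mk : ∀ i j : Fin n, i ≠ j → (M s(i, j)).prod = (N i j).prod := by
    intro i j hij
    rw [hM, if_neg (by rwa [Sym2.mk_isDiag_iff]), Sym2.inf_mk, Sym2.sup_mk]
    rcases le_total i j with h | h
    · rw [min_eq_left h, max_eq_right h]
    · rw [min_eq_right h, max_eq_left h, hN, hN, rowBlock_prod_comm hn]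
  have hprod_diag : ∀ i : Fin n, (M s(i, i)).prod = 1 := fun i => by
    rw [hM, if_pos (Sym2.mk_isDiag_iff.2 rfl), Multiset.prod_zero]
  have hf : (∏ b : Sym2 (Fin n), if b.IsDiag then 1 else
      ((univ : Finset (Fin n)).val.map fun k : Fin n =>
        (MvPolynomial.X (b.inf, k) - MvPolynomial.X (b.sup, k) : MvPolynomial (Fin n × Fin n) ℂ)).prod) =
      MvPolynomial.C 1 * ∏ b : Sym2 (Fin n), (M b).prod := by
    rw [map_one, one_mul]
    refine Finset.prod_congr rfl fun b _ => ?_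
    rw [hM]; split_ifs <;> simp [hN]
  rw [hf]
  refine qpOrbitRestorable_of_blocks (k := 3) M 1 (fun b q hq => ?_) (fun b q hq => ?_) (fun b => ?_)
    (fun σ b => ?_)
  · rw [hM] at hq
    split_ifs at hq with hb
    · simp at hq
    · obtain ⟨kk, -, rfl⟩ := Multiset.mem_map.1 hq
      refine (MvPolynomial.totalDegree_sub _ _).trans (max_le ?_ ?_) <;> exact (MvPolynomial.totalDegree_X _).le
  · rw [hM] at hq
    split_ifs at hq with hb
    · simp at hq
    · obtain ⟨kk, -, rfl⟩ := Multiset.mem_map.1 hq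
      refine ⟨{b.inf, b.sup, kk}, (Finset.card_le_three).trans le_rfl, fun σ hσ => ?_⟩
      simp only [Finset.mem_insert, Finset.mem_singleton, forall_eq_or_imp, forall_eq] at hσ
      simp only [map_sub, ren_X, Prod.smul_mk, Perm.smul_def, hσ.1, hσ.2.1, hσ.2.2]
  · refine ⟨{b.inf, b.sup}, (Finset.card_le_two).trans (by norm_num), fun σ hσ => ?_⟩
    simp only [Finset.mem_insert, Finset.mem_singleton, forall_eq_or_imp, forall_eq] at hσ
    rw [hM]
    split_ifs with hb
    · rfl
    · rw [hN, map_ren_rowBlock, hσ.1, hσ.2]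
  · induction b using Sym2.ind with
    | h i j =>
      rw [hsmul]
      by_cases hij : i = j
      · subst hij; rw [hprod_diag, hprod_diag, map_one]
      · rw [hprod_mk i j hij, hprod_mk (σ i) (σ j) (fun h => hij (σ.injective h)), hN, map_multiset_prod,
          map_ren_rowBlock]

end BlockProducts

end Summit.ValiantsHypothesis.ValiantsHypothesis.Theorems

end
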